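import Literature.MathematicalPhysics.QuantumFieldTheory.ConformalBootstrap3D.BlockCoefficientExistence
import Literature.MathematicalPhysics.QuantumFieldTheory.ConformalBootstrap3D.MixedBlockCoefficients
import Mathlib.Algebra.BigOperators.NatAntidiagonal
import Mathlib.Algebra.BigOperators.Field
import Mathlib.Tactic.Linarith
import Mathlib.Tactic.Ring
import Mathlib.Tactic.Positivity
import Mathlib.Tactic.FieldSimp
import HarnessLib

/-!
# (E_ab): the Dolan–Osborn `(a,b)` array solves the monomial Casimir system for unequal external dimensions

Companion of `BlockCoefficientExistence.lean` (the `a = b = 0` case) and `MixedBlockCoefficients.lean`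
(the general-`(a,b)` recursion `hrCoeffAB`, Dolan–Osborn 2004 §3 eqs. (3.9)–(3.12), `a = -Δ₁₂/2`,
`b = Δ₃₄/2`). Dolan–Osborn's eq. (3.9),

  `D_ε P_{λ₁λ₂} = [λ₁(λ₁-1) + λ₂(λ₂-1-ε)] P_{λ₁λ₂} - [(λ₋+ε)/(λ₋+ε/2)](λ₁+a)(λ₁+b) P_{λ₁+1,λ₂}
     - [λ₋/(λ₋+ε/2)](λ₂-ε/2+a)(λ₂-ε/2+b) P_{λ₁,λ₂+1}`   (`c = 0`),

proved there from the two Gegenbauer identities (3.8) for `(x+z)P` and `(x²∂_x + z²∂_z)P`, says at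
`d = 3`, coefficientwise in the monomial basis of `IsConformalBlock3DAbove` (`g = (z z̄)^α Σ k_{mn} z^m z̄^n`),
that the degree-raising part of the typed coefficient operator `coeffCasimirLHS a b Δ ℓ` (weights
`C(a,b), D(a,b), E(a,b)` of `BlockCoefficientUniqueness`) maps the Legendre monomial array `e_{N,j}` to
`-(γ⁺_{E,j}(a,b)/2) [(z-z̄) e_{N+1,j+1}] - (γ⁻_{E,j}(a,b)/2) [(z-z̄) e_{N+1,j-1}]` with the weights
`hrGammaPlusAB`, `hrGammaMinusAB` — **Identity II with `(a,b)`** (`coeffLCDE_legendreArrAB`; the same seven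
cases as the `a = b = 0` Identity II, each now a polynomial identity in `(a,b,Δ)`; Identity I is
`(a,b)`-independent and is imported). Consequently the array

  `hrMonomialCoeffAB a b Δ ℓ (m,n) = λ_ℓ⁻¹ Σ_j A_{m+n-ℓ, j}(a,b) e_{m+n,j}(m,n)`

SOLVES `SatisfiesCoeffCasimir a b Δ ℓ` for every `Δ` strictly above the unitarity bound
(`hrMonomialCoeffAB_satisfies`), is symmetric, and has the Dolan–Osborn leading part `k_{m0} = δ_{mℓ}`
(`m ≤ ℓ`) for every `(a,b)`; with the uniqueness theorem (valid for all `(a,b)`) every solution off the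
accidental degeneracies IS this array (`SatisfiesCoeffCasimir.eq_hrMonomialCoeffAB`), non-negative for
`a = b` (`.nonneg_of_self` — Hartman–Jain–Kundu 2016 §4.4 / FKPS-D 2013 App. A positivity as a theorem at
`d = 3`), with diagonal coefficients `hrLevelSumAB a b Δ ℓ n / λ_ℓ` (`.diagCoeff_eq_ab`). Together with
`BlockCoefficientExtraction` (`(α)`, all `(Δ₁₂,Δ₃₄)`) this is REFEREE T1 at coefficient level for the mixed
families `gmm = g^{Δ_σε,Δ_σε}` (`a = -b`) and `gpm = g^{-Δ_σε,Δ_σε}` (`a = b`) of the σ–ε sum rules 3–5.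

Exact prototype: pub-ising3d `pub-ising3d-lit-g2/code/check_do2004_ab_recursion.py` (the `(a,b)` recursion
in the monomial basis equals the referee's direct exact solver of this very system, 11 parameter sets,
levels `≤ 6`, 0 mismatches). What is NOT here: convergence / resummation (see `BlockCoefficientExtraction`,
`BlockZSeries` for `a = b = 0`; their `(a,b)` versions are mechanical given this file), and anything at the
poles `Δ = ℓ+1` (`ℓ ≥ 1`, `ab ≠ 0`: `MixedBlockCoefficients.hrCoeffAB_one_pred`).
[cite: DolanOsborn2004, §3 eqs. (3.8)–(3.12)]
-/

namespace Literature.MathematicalPhysics.QuantumFieldTheory.ConformalBootstrap3D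

open Finset

/-! ### Identity II with `(a,b)`: `𝒟₁(a,b) 𝒫_{E,j} = -γ⁺(a,b) 𝒫_{E+1,j+1} - γ⁻(a,b) 𝒫_{E+1,j-1}` coefficientwise -/

/-- **Identity II with general `(a,b)`** (Dolan–Osborn 2004 eq. (3.9): the degree-raising part `𝒟₁(a,b)`
of the Casimir operator — including the terms `-(a+b)(z²∂_z + z̄²∂_z̄)` and `-ab(z+z̄)` — maps `s^E P_j`
to `-γ⁺_{E,j}(a,b) s^{E+1} P_{j+1} - γ⁻_{E,j}(a,b) s^{E+1} P_{j-1}`, by their eq. (3.8); at `d = 3`,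
coefficientwise in the monomial basis, in the normalisation of `CasimirEq3D` (factor `1/2`)): on output
degree `2t + j + 2`, `coeffLCDE a b (e_{t,j}) = -(γ⁺(a,b)/2)·[(z - z̄) e_{t,j+1}] - (γ⁻(a,b)/2)·[(z - z̄) e_{t+1,j-1}]`.
Same seven cases as the `a = b = 0` Identity II of `BlockCoefficientExistence`; each is a polynomial identity in
`(a, b, Δ)` after the `λ`-recurrence. [cite: DolanOsborn2004, §3 eqs. (3.8)–(3.9)] -/
theorem coeffLCDE_legendreArrAB (a b Δ : ℝ) (ℓ t j P Q : ℕ) (hPQ : P + Q = 2 * t + j + 2) :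
    coeffLCDE a b Δ ℓ (legendreArr t j) P Q =
      -(hrGammaPlusAB a b (levelE Δ ℓ t j) j / 2) * zdiff (legendreArr t (j + 1)) P Q
        - (hrGammaMinusAB a b (levelE Δ ℓ t j) j / 2) * zdiff (legendreArr (t + 1) (j - 1)) P Q := by
  have hj0 : (2 * (j : ℝ) + 1) ≠ 0 := by positivity
  rcases (show P < t ∨ P = t ∨ P = t + 1 ∨ (t + 2 ≤ P ∧ P ≤ t + j) ∨ (P = t + j + 1 ∧ 1 ≤ j) ∨
      P = t + j + 2 ∨ t + j + 3 ≤ P by omega) with h | h | h | ⟨h1, h2⟩ | ⟨h, hj⟩ | h | h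
  · -- (a) left of everything
    unfold coeffLCDE zdiff
    rw [legendreArr_pair_eq_zero t j (P - 2) Q (by omega),
      legendreArr_pair_eq_zero t j (P - 1) (Q - 1) (by omega),
      legendreArr_pair_eq_zero t j P (Q - 2) (by omega),
      legendreArr_pair_eq_zero t (j + 1) (P - 1) Q (by omega),
      legendreArr_pair_eq_zero t (j + 1) P (Q - 1) (by omega),
      legendreArr_pair_eq_zero (t + 1) (j - 1) (P - 1) Q (by omega),
      legendreArr_pair_eq_zero (t + 1) (j - 1) P (Q - 1) (by omega)]
    simp
  · -- (b) P = t: `E`-source `(t, t+j)` against `e_{t,j+1}(t, t+j+1)`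
    have g3 : 2 ≤ Q := by omega
    have g5 : 1 ≤ Q := by omega
    unfold coeffLCDE zdiff
    rw [legendreArr_pair_eq_zero t j (P - 2) Q (by omega),
      legendreArr_pair_eq_zero t j (P - 1) (Q - 1) (by omega),
      legendreArr_pair t j P (Q - 2) 0 j (by omega) (by omega) (by omega),
      legendreArr_pair_eq_zero t (j + 1) (P - 1) Q (by omega),
      legendreArr_pair t (j + 1) P (Q - 1) 0 (j + 1) (by omega) (by omega) (by omega),
      legendreArr_pair_eq_zero (t + 1) (j - 1) (P - 1) Q (by omega),
      legendreArr_pair_eq_zero (t + 1) (j - 1) P (Q - 1) (by omega)]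
    simp only [mul_zero, ite_self, zero_add, add_zero, sub_zero, zero_sub, g3, g5, if_true]
    rw [show Q - 2 = t + j by omega, legendreLam_succ j]
    unfold coeffE hrGammaPlusAB levelE halfTwist
    push_cast
    field_simp
    ring
  · -- (c) P = t+1
    rcases Nat.eq_zero_or_pos j with hj | hj
    · -- j = 0: both sides vanish (`D(t,t) = 0`)
      subst hj
      have g2 : 1 ≤ P ∧ 1 ≤ Q := ⟨by omega, by omega⟩
      unfold coeffLCDE zdiff
      rw [legendreArr_pair_eq_zero t 0 (P - 2) Q (by omega),
        legendreArr_pair t 0 (P - 1) (Q - 1) 0 0 (by omega) (by omega) (by omega),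
        legendreArr_pair_eq_zero t 0 P (Q - 2) (by omega),
        legendreArr_pair t (0 + 1) (P - 1) Q 0 1 (by omega) (by omega) (by omega),
        legendreArr_pair t (0 + 1) P (Q - 1) 1 0 (by omega) (by omega) (by omega),
        legendreArr_pair_eq_zero (t + 1) (0 - 1) (P - 1) Q (by omega),
        legendreArr_pair_eq_zero (t + 1) (0 - 1) P (Q - 1) (by omega)]
      simp only [mul_zero, ite_self, zero_add, add_zero, sub_zero, g2, if_true, and_self]
      rw [show P - 1 = t by omega, show Q - 1 = t by omega]
      unfold coeffD
      ring
    · obtain ⟨j', rfl⟩ : ∃ j', j = j' + 1 := ⟨j - 1, by omega⟩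
      have g2 : 1 ≤ P ∧ 1 ≤ Q := ⟨by omega, by omega⟩
      have g3 : 2 ≤ Q := by omega
      unfold coeffLCDE zdiff
      rw [legendreArr_pair_eq_zero t (j' + 1) (P - 2) Q (by omega),
        legendreArr_pair t (j' + 1) (P - 1) (Q - 1) 0 (j' + 1) (by omega) (by omega) (by omega),
        legendreArr_pair t (j' + 1) P (Q - 2) 1 j' (by omega) (by omega) (by omega),
        legendreArr_pair t (j' + 1 + 1) (P - 1) Q 0 (j' + 2) (by omega) (by omega) (by omega),
        legendreArr_pair t (j' + 1 + 1) P (Q - 1) 1 (j' + 1) (by omega) (by omega) (by omega),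
        legendreArr_pair_eq_zero (t + 1) (j' + 1 - 1) (P - 1) Q (by omega),
        legendreArr_pair (t + 1) (j' + 1 - 1) P (Q - 1) 0 j' (by omega) (by omega) (by omega)]
      simp only [mul_zero, ite_self, zero_add, zero_sub, g2, g3, if_true, and_self]
      rw [show P - 1 = t by omega, show Q - 1 = t + (j' + 1) by omega, show Q - 2 = t + j' by omega]
      rw [show j' + 2 = j' + 1 + 1 by ring, legendreLam_succ (j' + 1), legendreLam_succ j',
        legendreLam_one, legendreLam_zero]
      unfold coeffD coeffE hrGammaPlusAB hrGammaMinusAB levelE halfTwist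
      have h1 : (2 * (j' : ℝ) + 2) ≠ 0 := by positivity
      have h2 : (2 * ((j' : ℝ) + 1) + 2) ≠ 0 := by positivity
      push_cast
      field_simp
      ring
  · -- (d) generic: P = t+i'+2, Q = t+r'+2, j = i'+r'+2; all seven values present
    obtain ⟨i', r', hP, hQ, hj⟩ : ∃ i' r', P = t + i' + 2 ∧ Q = t + r' + 2 ∧ j = i' + r' + 2 :=
      ⟨P - t - 2, Q - t - 2, by omega, by omega, by omega⟩
    have g1 : 2 ≤ P := by omega
    have g2 : 1 ≤ P ∧ 1 ≤ Q := ⟨by omega, by omega⟩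
    have g3 : 2 ≤ Q := by omega
    unfold coeffLCDE zdiff
    rw [legendreArr_pair t j (P - 2) Q i' (r' + 2) (by omega) (by omega) (by omega),
      legendreArr_pair t j (P - 1) (Q - 1) (i' + 1) (r' + 1) (by omega) (by omega) (by omega),
      legendreArr_pair t j P (Q - 2) (i' + 2) r' (by omega) (by omega) (by omega),
      legendreArr_pair t (j + 1) (P - 1) Q (i' + 1) (r' + 2) (by omega) (by omega) (by omega),
      legendreArr_pair t (j + 1) P (Q - 1) (i' + 2) (r' + 1) (by omega) (by omega) (by omega),
      legendreArr_pair (t + 1) (j - 1) (P - 1) Q i' (r' + 1) (by omega) (by omega) (by omega),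
      legendreArr_pair (t + 1) (j - 1) P (Q - 1) (i' + 1) r' (by omega) (by omega) (by omega)]
    simp only [g1, g2, g3, if_true, and_self]
    rw [show P - 2 = t + i' by omega, show P - 1 = t + i' + 1 by omega, show Q - 1 = t + r' + 1 by omega,
      show Q - 2 = t + r' by omega]
    subst hj
    rw [show i' + 2 = i' + 1 + 1 by ring, show r' + 2 = r' + 1 + 1 by ring,
      legendreLam_succ (i' + 1), legendreLam_succ i', legendreLam_succ (r' + 1), legendreLam_succ r']
    unfold coeffC coeffD coeffE hrGammaPlusAB hrGammaMinusAB levelE halfTwist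
    have h1 : (2 * (i' : ℝ) + 2) ≠ 0 := by positivity
    have h2 : (2 * ((i' : ℝ) + 1) + 2) ≠ 0 := by positivity
    have h3 : (2 * (r' : ℝ) + 2) ≠ 0 := by positivity
    have h4 : (2 * ((r' : ℝ) + 1) + 2) ≠ 0 := by positivity
    push_cast
    field_simp
    ring
  · -- (e) P = t+j+1, j ≥ 1: mirror of (c)
    obtain ⟨j', rfl⟩ : ∃ j', j = j' + 1 := ⟨j - 1, by omega⟩
    have g1 : 2 ≤ P := by omega
    have g2 : 1 ≤ P ∧ 1 ≤ Q := ⟨by omega, by omega⟩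
    unfold coeffLCDE zdiff
    rw [legendreArr_pair t (j' + 1) (P - 2) Q j' 1 (by omega) (by omega) (by omega),
      legendreArr_pair t (j' + 1) (P - 1) (Q - 1) (j' + 1) 0 (by omega) (by omega) (by omega),
      legendreArr_pair_eq_zero t (j' + 1) P (Q - 2) (by omega),
      legendreArr_pair t (j' + 1 + 1) (P - 1) Q (j' + 1) 1 (by omega) (by omega) (by omega),
      legendreArr_pair t (j' + 1 + 1) P (Q - 1) (j' + 2) 0 (by omega) (by omega) (by omega),
      legendreArr_pair (t + 1) (j' + 1 - 1) (P - 1) Q j' 0 (by omega) (by omega) (by omega),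
      legendreArr_pair_eq_zero (t + 1) (j' + 1 - 1) P (Q - 1) (by omega)]
    simp only [mul_zero, ite_self, add_zero, sub_zero, g1, g2, if_true, and_self]
    rw [show P - 2 = t + j' by omega, show P - 1 = t + (j' + 1) by omega, show Q - 1 = t by omega]
    rw [show j' + 2 = j' + 1 + 1 by ring, legendreLam_succ (j' + 1), legendreLam_succ j',
      legendreLam_one, legendreLam_zero]
    unfold coeffC coeffD hrGammaPlusAB hrGammaMinusAB levelE halfTwist
    have h1 : (2 * (j' : ℝ) + 2) ≠ 0 := by positivity
    have h2 : (2 * ((j' : ℝ) + 1) + 2) ≠ 0 := by positivity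
    push_cast
    field_simp
    ring
  · -- (f) P = t+j+2: `C`-source `(t+j, t)` against `e_{t,j+1}(t+j+1, t)`
    have g1 : 2 ≤ P := by omega
    have g4 : 1 ≤ P := by omega
    unfold coeffLCDE zdiff
    rw [legendreArr_pair t j (P - 2) Q j 0 (by omega) (by omega) (by omega),
      legendreArr_pair_eq_zero t j (P - 1) (Q - 1) (by omega),
      legendreArr_pair_eq_zero t j P (Q - 2) (by omega),
      legendreArr_pair t (j + 1) (P - 1) Q (j + 1) 0 (by omega) (by omega) (by omega),
      legendreArr_pair_eq_zero t (j + 1) P (Q - 1) (by omega),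
      legendreArr_pair_eq_zero (t + 1) (j - 1) (P - 1) Q (by omega),
      legendreArr_pair_eq_zero (t + 1) (j - 1) P (Q - 1) (by omega)]
    simp only [mul_zero, ite_self, add_zero, sub_zero, g1, g4, if_true]
    rw [show P - 2 = t + j by omega, legendreLam_succ j]
    unfold coeffC hrGammaPlusAB levelE halfTwist
    push_cast
    field_simp
    ring
  · -- (g) right of everything
    unfold coeffLCDE zdiff
    rw [legendreArr_pair_eq_zero t j (P - 2) Q (by omega),
      legendreArr_pair_eq_zero t j (P - 1) (Q - 1) (by omega),
      legendreArr_pair_eq_zero t j P (Q - 2) (by omega),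
      legendreArr_pair_eq_zero t (j + 1) (P - 1) Q (by omega),
      legendreArr_pair_eq_zero t (j + 1) P (Q - 1) (by omega),
      legendreArr_pair_eq_zero (t + 1) (j - 1) (P - 1) Q (by omega),
      legendreArr_pair_eq_zero (t + 1) (j - 1) P (Q - 1) (by omega)]
    simp

/-- Identity II with `(a,b)` in degree form (for `j ≤ N`). [cite: DolanOsborn2004, §3 eq. (3.9)] -/
theorem coeffLCDE_legendreArrDegAB (a b Δ : ℝ) (ℓ N j P Q : ℕ) (hPQ : P + Q = N + 2) (hjN : j ≤ N) :
    coeffLCDE a b Δ ℓ (legendreArrDeg N j) P Q =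
      -(hrGammaPlusAB a b (Δ + (N : ℝ) - ℓ) j / 2) * zdiff (legendreArrDeg (N + 1) (j + 1)) P Q
        - (hrGammaMinusAB a b (Δ + (N : ℝ) - ℓ) j / 2) * zdiff (legendreArrDeg (N + 1) (j - 1)) P Q := by
  by_cases h : (N + j) % 2 = 0
  · have hN' : 2 * ((N - j) / 2) + j = N := by omega
    have hN : ((2 * ((N - j) / 2) + j : ℕ) : ℝ) = (N : ℝ) := by exact_mod_cast hN'
    have hE : levelE Δ ℓ ((N - j) / 2) j = Δ + (N : ℝ) - ℓ := by
      unfold levelE; rw [hN]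
    have h1 : legendreArrDeg N j = legendreArr ((N - j) / 2) j := by
      unfold legendreArrDeg; rw [if_pos ⟨hjN, h⟩]
    have h2 : legendreArrDeg (N + 1) (j + 1) = legendreArr ((N - j) / 2) (j + 1) := by
      unfold legendreArrDeg
      rw [if_pos ⟨by omega, by omega⟩]
      congr 1
      omega
    rcases Nat.eq_zero_or_pos j with hj | hj
    · subst hj
      rw [h1, h2, hrGammaMinusAB_zero, ← hE]
      have := coeffLCDE_legendreArrAB a b Δ ℓ ((N - 0) / 2) 0 P Q (by omega)
      rw [hrGammaMinusAB_zero] at this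
      simpa using this
    · have h3 : legendreArrDeg (N + 1) (j - 1) = legendreArr ((N - j) / 2 + 1) (j - 1) := by
        unfold legendreArrDeg
        rw [if_pos ⟨by omega, by omega⟩]
        congr 1
        omega
      rw [h1, h2, h3, ← hE]
      exact coeffLCDE_legendreArrAB a b Δ ℓ _ j P Q (by omega)
  · -- wrong parity: everything vanishes (`e_{N,j} = 0`, `e_{N+1,j±1} = 0` or `γ⁻_{E,0} = 0`)
    have h1 : legendreArrDeg N j = 0 := by
      unfold legendreArrDeg; rw [if_neg (fun hc => h hc.2)]
    have h2 : legendreArrDeg (N + 1) (j + 1) = 0 := by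
      unfold legendreArrDeg; rw [if_neg (fun hc => by omega)]
    rcases Nat.eq_zero_or_pos j with hj | hj
    · subst hj
      rw [h1, h2, hrGammaMinusAB_zero]
      simp [coeffLCDE, zdiff]
    · have h3 : legendreArrDeg (N + 1) (j - 1) = 0 := by
        unfold legendreArrDeg; rw [if_neg (fun hc => by omega)]
      rw [h1, h2, h3]
      simp [coeffLCDE, zdiff]

/-! ### The Dolan–Osborn `(a,b)` solution in the monomial basis -/

/-- The degree-`N` slice of the Dolan–Osborn solution with general `(a,b)`: `Σ_j (A_{N-ℓ, j} / λ_ℓ) e_{N,j}` (Dolan–Osborn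
normalisation `k_{ℓ,0} = 1`; HR normalise the leading term to `𝒫_{Δ,ℓ}`, whose `z^{α+ℓ} z̄^{α}`
coefficient is `λ_ℓ`). [cite: DolanOsborn2004, §3 eqs. (3.10)–(3.11)] -/
noncomputable def hrSliceAB (a b Δ : ℝ) (ℓ N : ℕ) (p : ℕ × ℕ) : ℝ :=
  ∑ j ∈ range (N + 1), (hrCoeffAB a b Δ ℓ (N - ℓ) j / legendreLam ℓ) * legendreArrDeg N j p

/-- **The candidate double-power-series coefficients of `g^{Δ₁₂,Δ₃₄}_{Δ,ℓ}` from the `(a,b)` `z`-series**: `k_{mn}` for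
`m + n = N ≥ ℓ` is `Σ_j (A_{N-ℓ,j}/λ_ℓ) e_{N,j}(m,n) = λ_ℓ⁻¹ Σ_{t ≤ min(m,n)} A_{N-ℓ, N-2t} λ_{m-t} λ_{n-t}`
(the expansion of `Σ_{n,j} A_{n,j} 𝒫_{Δ+n,j}` in monomials `z^{α+m} z̄^{α+n}` via
`P_j(cos θ) = Σ_{i+r=j} λ_i λ_r e^{i(i-r)θ}`), and `0` below degree `ℓ`.
[cite: DolanOsborn2004, §3 eqs. (3.10)–(3.11)] -/
noncomputable def hrMonomialCoeffAB (a b Δ : ℝ) (ℓ : ℕ) (p : ℕ × ℕ) : ℝ :=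
  if ℓ ≤ p.1 + p.2 then hrSliceAB a b Δ ℓ (p.1 + p.2) p else 0

/-- Slices are supported on their degree. [folklore] -/
theorem hrSliceAB_eq_zero_of_ne (a b Δ : ℝ) (ℓ : ℕ) {N : ℕ} {p : ℕ × ℕ} (h : p.1 + p.2 ≠ N) :
    hrSliceAB a b Δ ℓ N p = 0 :=
  Finset.sum_eq_zero fun j _ => by rw [legendreArrDeg_eq_zero_of_ne h, mul_zero]

/-- On degree `N ≥ ℓ` the array is its degree-`N` slice. [folklore] -/
theorem hrMonomialCoeffAB_eq_slice (a b Δ : ℝ) (ℓ : ℕ) {N : ℕ} {p : ℕ × ℕ} (h : p.1 + p.2 = N)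
    (hℓ : ℓ ≤ N) : hrMonomialCoeffAB a b Δ ℓ p = hrSliceAB a b Δ ℓ N p := by
  unfold hrMonomialCoeffAB
  rw [if_pos (by omega), h]

/-- Below degree `ℓ` the array vanishes. [folklore] -/
theorem hrMonomialCoeffAB_eq_zero_of_lt (a b Δ : ℝ) (ℓ : ℕ) {p : ℕ × ℕ} (h : p.1 + p.2 < ℓ) :
    hrMonomialCoeffAB a b Δ ℓ p = 0 := by
  unfold hrMonomialCoeffAB
  rw [if_neg (by omega)]

/-- The array is symmetric. [folklore] -/
theorem hrMonomialCoeffAB_symm (a b Δ : ℝ) (ℓ : ℕ) (p : ℕ × ℕ) :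
    hrMonomialCoeffAB a b Δ ℓ (p.2, p.1) = hrMonomialCoeffAB a b Δ ℓ p := by
  unfold hrMonomialCoeffAB hrSliceAB
  simp only
  rw [Nat.add_comm p.2 p.1]
  split_ifs
  · exact Finset.sum_congr rfl fun j _ => by rw [legendreArrDeg_symm]
  · rfl

/-- The array satisfies the Dolan–Osborn boundary condition `k_{m,0} = 0 (m < ℓ)`, `k_{ℓ,0} = 1`, for every
`(a,b)` (the typed normalisation `c_ℓ = 1` uniformly in `Δ₁₂, Δ₃₄`). [cite: DolanOsborn2004, §3 eq. (3.14)] -/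
theorem hrMonomialCoeffAB_hasLeadingPart (a b Δ : ℝ) (ℓ : ℕ) : HasLeadingPart ℓ (hrMonomialCoeffAB a b Δ ℓ) := by
  refine ⟨fun m hm => hrMonomialCoeffAB_eq_zero_of_lt a b Δ ℓ (by simpa using hm), ?_⟩
  rw [hrMonomialCoeffAB_eq_slice a b Δ ℓ (N := ℓ) (by simp) le_rfl]
  unfold hrSliceAB
  rw [Finset.sum_eq_single ℓ]
  · rw [Nat.sub_self, hrCoeffAB_zero_self]
    unfold legendreArrDeg
    rw [if_pos ⟨le_rfl, by omega⟩, legendreArr_pair ((ℓ - ℓ) / 2) ℓ ℓ 0 ℓ 0 (by omega) (by omega)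
      (by omega), legendreLam_zero, mul_one, div_mul_cancel₀ _ (legendreLam_ne_zero ℓ)]
  · intro j _ hj
    rw [Nat.sub_self, hrCoeffAB_zero_of_ne a b Δ hj, zero_div, zero_mul]
  · intro h
    exact absurd (mem_range.mpr (Nat.lt_succ_self ℓ)) h

/-- For `a = b` (the reflection-positive ordering) the array is entrywise non-negative above the unitarity
bound (`hrCoeffAB_self_nonneg`, `λ_i > 0`): the monomial form of Hartman–Jain–Kundu 2016 §4.4 / FKPS-D 2013
App. A positivity, here at `d = 3` for every real `a`. [cite: DolanOsborn2004, §3 eq. (3.11)] -/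
theorem hrMonomialCoeffAB_self_nonneg {Δ : ℝ} {ℓ : ℕ} (a : ℝ) (hΔ : unitarityBound3D ℓ < Δ) (p : ℕ × ℕ) :
    0 ≤ hrMonomialCoeffAB a a Δ ℓ p := by
  unfold hrMonomialCoeffAB hrSliceAB
  split_ifs
  · exact Finset.sum_nonneg fun j _ =>
      mul_nonneg (div_nonneg (hrCoeffAB_self_nonneg a hΔ _ _) (legendreLam_pos ℓ).le)
        (legendreArrDeg_nonneg _ _ _)
  · exact le_rfl

/-- **Diagonal sums**: `d_{ℓ+n} = Σ_{m+m'=ℓ+n} k_{mm'} = a_n(Δ,ℓ)/λ_ℓ` with `a_n = hrLevelSumAB a b Δ ℓ n`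
the level sum of the `z`-series coefficients (`P_j(1) = 1`); coefficients off the descendant range
vanish by `hrCoeffAB_support`. [cite: DolanOsborn2004, §3 eq. (3.10)] -/
theorem diagCoeff_hrMonomialCoeffAB (a b Δ : ℝ) (ℓ n : ℕ) :
    diagCoeff (hrMonomialCoeffAB a b Δ ℓ) (ℓ + n) = hrLevelSumAB a b Δ ℓ n / legendreLam ℓ := by
  unfold diagCoeff
  have h1 : ∑ p ∈ antidiagonal (ℓ + n), hrMonomialCoeffAB a b Δ ℓ p =
      ∑ p ∈ antidiagonal (ℓ + n), hrSliceAB a b Δ ℓ (ℓ + n) p :=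
    Finset.sum_congr rfl fun p hp => hrMonomialCoeffAB_eq_slice a b Δ ℓ (mem_antidiagonal.mp hp) (by omega)
  rw [h1]
  unfold hrSliceAB
  rw [Finset.sum_comm]
  simp_rw [← Finset.mul_sum, sum_antidiagonal_legendreArrDeg, Nat.add_sub_cancel_left]
  unfold hrLevelSumAB
  rw [Finset.sum_div]
  refine Finset.sum_congr rfl fun j hj => ?_
  split_ifs with hc
  · rw [mul_one]
  · have hj' := mem_range.mp hj
    rw [mul_zero, hrCoeffAB_eq_zero_of_not_inDescendantRange a b Δ (fun hr => hc ⟨by omega, ?_⟩), zero_div]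
    obtain ⟨_, _, h3⟩ := hr
    omega

/-- The `(a,b)` recursion in multiplied-out form for ALL `(n+1, j)` above the unitarity bound: on the
descendant range the pivot is positive (`casimirPivot3D_pos`), off it both sides vanish (a child off
the range has both parents off the range). [cite: DolanOsborn2004, §3 eq. (3.12)] -/
theorem hrCoeffAB_succ_rec_all {a b Δ : ℝ} {ℓ : ℕ} (hΔ : unitarityBound3D ℓ < Δ) (n j : ℕ) :
    casimirPivot3D Δ ℓ (n + 1) j * hrCoeffAB a b Δ ℓ (n + 1) j =
      (if j = 0 then 0 else hrGammaPlusAB a b (Δ + n) (j - 1) * hrCoeffAB a b Δ ℓ n (j - 1)) +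
        hrGammaMinusAB a b (Δ + n) (j + 1) * hrCoeffAB a b Δ ℓ n (j + 1) := by
  by_cases hr : InDescendantRange ℓ (n + 1) j
  · obtain ⟨h1, h2, h3⟩ := hr
    exact hrCoeffAB_succ_rec (casimirPivot3D_pos hΔ (by omega) h1 h2 h3).ne'
  · rw [hrCoeffAB_eq_zero_of_not_inDescendantRange a b Δ hr, mul_zero]
    have hp : hrCoeffAB a b Δ ℓ n (j + 1) = 0 :=
      hrCoeffAB_eq_zero_of_not_inDescendantRange a b Δ fun ⟨h1, h2, h3⟩ => hr ⟨by omega, by omega, by omega⟩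
    rw [hp, mul_zero, add_zero]
    split_ifs with hj
    · rfl
    · have hm : hrCoeffAB a b Δ ℓ n (j - 1) = 0 :=
        hrCoeffAB_eq_zero_of_not_inDescendantRange a b Δ fun ⟨h1, h2, h3⟩ =>
          hr ⟨by omega, by omega, by omega⟩
      rw [hm, mul_zero]

/-! ### Assembly -/

/-- **(E_ab) Existence / identification for general external dimensions: the Dolan–Osborn array solves the
coefficient Casimir system `SatisfiesCoeffCasimir a b Δ ℓ`** strictly above the 3D unitarity bound — for EVERY
such `Δ` and every real `a = -Δ₁₂/2`, `b = Δ₃₄/2`, accidental degeneracies included (there it is one of several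
solutions). Assembly of Identity I (`a,b`-independent, from `BlockCoefficientExistence`), Identity II with
`(a,b)` (`coeffLCDE_legendreArrDegAB`) and the recursion termwise (`hrCoeffAB_succ_rec_all`); the assembly is
that of `hrMonomialCoeff_satisfies` verbatim. [cite: DolanOsborn2004, §3 eqs. (3.9)–(3.12)] -/
theorem hrMonomialCoeffAB_satisfies {Δ : ℝ} {ℓ : ℕ} (a b : ℝ) (hΔ : unitarityBound3D ℓ < Δ) :
    SatisfiesCoeffCasimir a b Δ ℓ (hrMonomialCoeffAB a b Δ ℓ) := by
  intro P Q
  rw [coeffCasimirLHS_eq_add]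
  have hLAB0 : coeffLAB Δ ℓ (fun _ => (0 : ℝ)) P Q = 0 := by simp [coeffLAB]
  have hLCDE0 : coeffLCDE a b Δ ℓ (fun _ => (0 : ℝ)) P Q = 0 := by simp [coeffLCDE]
  rcases Nat.lt_or_ge (P + Q) (ℓ + 1) with hM | hM
  · -- every entry referenced has degree `< ℓ`
    rw [coeffLAB_congr Δ ℓ (k' := fun _ => (0 : ℝ))
        (fun hP => hrMonomialCoeffAB_eq_zero_of_lt a b Δ ℓ (by show P - 1 + Q < ℓ; omega))
        (fun hQ => hrMonomialCoeffAB_eq_zero_of_lt a b Δ ℓ (by show P + (Q - 1) < ℓ; omega)),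
      coeffLCDE_congr a b Δ ℓ (k' := fun _ => (0 : ℝ))
        (fun hP => hrMonomialCoeffAB_eq_zero_of_lt a b Δ ℓ (by show P - 2 + Q < ℓ; omega))
        (fun hP hQ => hrMonomialCoeffAB_eq_zero_of_lt a b Δ ℓ (by show P - 1 + (Q - 1) < ℓ; omega))
        (fun hQ => hrMonomialCoeffAB_eq_zero_of_lt a b Δ ℓ (by show P + (Q - 2) < ℓ; omega)),
      hLAB0, hLCDE0, add_zero]
  by_cases hM1 : P + Q = ℓ + 1
  · -- output degree `ℓ + 1`: sources of degree `ℓ` (only `j = ℓ`, zero Casimir shift) and `ℓ - 1` (none)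
    rw [coeffLAB_congr Δ ℓ (k' := hrSliceAB a b Δ ℓ ℓ)
        (fun hP => hrMonomialCoeffAB_eq_slice a b Δ ℓ (by show P - 1 + Q = ℓ; omega) le_rfl)
        (fun hQ => hrMonomialCoeffAB_eq_slice a b Δ ℓ (by show P + (Q - 1) = ℓ; omega) le_rfl),
      coeffLCDE_congr a b Δ ℓ (k' := fun _ => (0 : ℝ))
        (fun hP => hrMonomialCoeffAB_eq_zero_of_lt a b Δ ℓ (by show P - 2 + Q < ℓ; omega))
        (fun hP hQ => hrMonomialCoeffAB_eq_zero_of_lt a b Δ ℓ (by show P - 1 + (Q - 1) < ℓ; omega))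
        (fun hQ => hrMonomialCoeffAB_eq_zero_of_lt a b Δ ℓ (by show P + (Q - 2) < ℓ; omega)),
      hLCDE0, add_zero]
    unfold hrSliceAB
    rw [coeffLAB_sum]
    refine Finset.sum_eq_zero fun j _ => ?_
    rw [coeffLAB_legendreArrDeg Δ ℓ ℓ j P Q hM1, Nat.sub_self]
    by_cases hjl : j = ℓ
    · subst hjl
      have h0 : casShiftDeg Δ j j j = 0 := by unfold casShiftDeg; simp
      rw [h0, zero_mul, mul_zero]
    · rw [hrCoeffAB_zero_of_ne a b Δ hjl, zero_div, zero_mul]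
  · -- output degree `ℓ + n₂ + 2`, `n₂ ≥ 0`: sources of degree `N₁ = ℓ + n₂ + 1` and `N₂ = ℓ + n₂`
    obtain ⟨n₂, hn⟩ : ∃ n₂, P + Q = ℓ + n₂ + 2 := ⟨P + Q - ℓ - 2, by omega⟩
    rw [coeffLAB_congr Δ ℓ (k' := hrSliceAB a b Δ ℓ (ℓ + n₂ + 1))
        (fun hP => hrMonomialCoeffAB_eq_slice a b Δ ℓ (by show P - 1 + Q = ℓ + n₂ + 1; omega) (by omega))
        (fun hQ => hrMonomialCoeffAB_eq_slice a b Δ ℓ (by show P + (Q - 1) = ℓ + n₂ + 1; omega) (by omega)),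
      coeffLCDE_congr a b Δ ℓ (k' := hrSliceAB a b Δ ℓ (ℓ + n₂))
        (fun hP => hrMonomialCoeffAB_eq_slice a b Δ ℓ (by show P - 2 + Q = ℓ + n₂; omega) (by omega))
        (fun hP hQ => hrMonomialCoeffAB_eq_slice a b Δ ℓ (by show P - 1 + (Q - 1) = ℓ + n₂; omega)
          (by omega))
        (fun hQ => hrMonomialCoeffAB_eq_slice a b Δ ℓ (by show P + (Q - 2) = ℓ + n₂; omega) (by omega))]
    unfold hrSliceAB
    rw [coeffLAB_sum, coeffLCDE_sum]
    have hi1 : ℓ + n₂ + 1 - ℓ = n₂ + 1 := by omega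
    have hi2 : ℓ + n₂ - ℓ = n₂ := by omega
    have hE : Δ + ((ℓ + n₂ : ℕ) : ℝ) - ℓ = Δ + (n₂ : ℝ) := by push_cast; ring
    rw [hi1, hi2]
    have e1 : ∀ j ∈ range (ℓ + n₂ + 1 + 1),
        hrCoeffAB a b Δ ℓ (n₂ + 1) j / legendreLam ℓ * coeffLAB Δ ℓ (legendreArrDeg (ℓ + n₂ + 1) j) P Q =
          1 / (2 * legendreLam ℓ) * (casimirPivot3D Δ ℓ (n₂ + 1) j * hrCoeffAB a b Δ ℓ (n₂ + 1) j *
            zdiff (legendreArrDeg (ℓ + n₂ + 1) j) P Q) := by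
      intro j _
      rw [coeffLAB_legendreArrDeg Δ ℓ (ℓ + n₂ + 1) j P Q (by omega),
        ← two_mul_casShiftDeg Δ ℓ (n₂ + 1) j, show ℓ + (n₂ + 1) = ℓ + n₂ + 1 by ring]
      field_simp
    have e2 : ∀ j ∈ range (ℓ + n₂ + 1),
        hrCoeffAB a b Δ ℓ n₂ j / legendreLam ℓ * coeffLCDE a b Δ ℓ (legendreArrDeg (ℓ + n₂) j) P Q =
          1 / (2 * legendreLam ℓ) *
            (-(hrGammaPlusAB a b (Δ + n₂) j * hrCoeffAB a b Δ ℓ n₂ j *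
                zdiff (legendreArrDeg (ℓ + n₂ + 1) (j + 1)) P Q) -
              hrGammaMinusAB a b (Δ + n₂) j * hrCoeffAB a b Δ ℓ n₂ j *
                zdiff (legendreArrDeg (ℓ + n₂ + 1) (j - 1)) P Q) := by
      intro j hj
      have hj' := mem_range.mp hj
      rw [coeffLCDE_legendreArrDegAB a b Δ ℓ (ℓ + n₂) j P Q (by omega) (by omega), hE]
      field_simp
    rw [Finset.sum_congr rfl e1, Finset.sum_congr rfl e2, ← Finset.mul_sum, ← Finset.mul_sum,
      ← mul_add, Finset.sum_sub_distrib, Finset.sum_neg_distrib]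
    have key := sum_recursion_cancel (ℓ + n₂) (fun j => hrCoeffAB a b Δ ℓ (n₂ + 1) j)
      (fun j => hrCoeffAB a b Δ ℓ n₂ j) (fun j => casimirPivot3D Δ ℓ (n₂ + 1) j)
      (fun j => hrGammaPlusAB a b (Δ + n₂) j) (fun j => hrGammaMinusAB a b (Δ + n₂) j)
      (fun j => zdiff (legendreArrDeg (ℓ + n₂ + 1) j) P Q)
      (fun j => hrCoeffAB_succ_rec_all hΔ n₂ j) (hrGammaMinusAB_zero _ _ _)
      (hrCoeffAB_eq_zero_of_lt a b Δ (by omega)) (hrCoeffAB_eq_zero_of_lt a b Δ (by omega))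
    rw [show ℓ + n₂ + 2 = ℓ + n₂ + 1 + 1 by ring] at key
    linear_combination (1 / (2 * legendreLam ℓ)) * key

/-! ### Consequences via uniqueness (all `Δ₁₂, Δ₃₄`) -/

/-- `a = b = 0` recovers the Hogervorst–Rychkov array of `BlockCoefficientExistence`. [cite: DolanOsborn2004, §3 eq. (3.11)] -/
theorem hrMonomialCoeffAB_zero_zero (Δ : ℝ) (ℓ : ℕ) : hrMonomialCoeffAB 0 0 Δ ℓ = hrMonomialCoeff Δ ℓ := by
  funext p
  unfold hrMonomialCoeffAB hrMonomialCoeff hrSliceAB hrSlice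
  simp only [hrCoeffAB_zero_zero]

/-- **The block coefficients ARE the Dolan–Osborn coefficients, for every `(Δ₁₂, Δ₃₄)`.** Strictly above the
unitarity bound and off the accidental-degeneracy set, any symmetric solution of the coefficient Casimir
system `SatisfiesCoeffCasimir a b Δ ℓ` with the Dolan–Osborn boundary condition equals `hrMonomialCoeffAB a b Δ ℓ`
(uniqueness `SatisfiesCoeffCasimir.unique`, which holds for all `(a,b)`, + existence
`hrMonomialCoeffAB_satisfies`). With `BlockCoefficientExtraction.satisfiesCoeffCasimir_of_casimirEq3D` /
`IsConformalBlock3DAbove.exists_coeff` (also valid for all `(Δ₁₂, Δ₃₄)`) this identifies the double power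
series of the typed blocks `gmm = g^{Δ_σε,Δ_σε}` and `gpm = g^{-Δ_σε,Δ_σε}` of the σ–ε system at every regular
point. [cite: DolanOsborn2004, §3 eqs. (3.9)–(3.12)] -/
theorem SatisfiesCoeffCasimir.eq_hrMonomialCoeffAB {a b Δ : ℝ} {ℓ : ℕ} {k : ℕ × ℕ → ℝ}
    (hΔ : unitarityBound3D ℓ < Δ) (hreg : ¬ accidentalDegeneracy3D Δ ℓ)
    (hk : SatisfiesCoeffCasimir a b Δ ℓ k) (hks : ∀ p : ℕ × ℕ, k (p.2, p.1) = k p)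
    (hkl : HasLeadingPart ℓ k) : k = hrMonomialCoeffAB a b Δ ℓ :=
  hk.unique hΔ hreg (hrMonomialCoeffAB_satisfies a b hΔ) hks (hrMonomialCoeffAB_symm a b Δ ℓ) hkl
    (hrMonomialCoeffAB_hasLeadingPart a b Δ ℓ)

/-- Corollary (`a = b`, the reflection-positive ordering `⟨φ₁φ₂φ₂φ₁⟩`, e.g. `gpm`): at such `(Δ, ℓ)` every
coefficient `k_{mn}` of a solution is non-negative — Hartman–Jain–Kundu 2016 §4.4 ("positive coefficients when
`Δ₁₂ = -Δ₃₄`") as a theorem at `d = 3`. [cite: DolanOsborn2004, §3 eq. (3.11)] -/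
theorem SatisfiesCoeffCasimir.nonneg_of_self {a Δ : ℝ} {ℓ : ℕ} {k : ℕ × ℕ → ℝ}
    (hΔ : unitarityBound3D ℓ < Δ) (hreg : ¬ accidentalDegeneracy3D Δ ℓ)
    (hk : SatisfiesCoeffCasimir a a Δ ℓ k) (hks : ∀ p : ℕ × ℕ, k (p.2, p.1) = k p)
    (hkl : HasLeadingPart ℓ k) (p : ℕ × ℕ) : 0 ≤ k p := by
  rw [hk.eq_hrMonomialCoeffAB hΔ hreg hks hkl]
  exact hrMonomialCoeffAB_self_nonneg a hΔ p

/-- Corollary: at such `(Δ, ℓ)` the diagonal coefficients of a solution are the `(a,b)` level sums,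
`d_{ℓ+n} = hrLevelSumAB a b Δ ℓ n / λ_ℓ` (for `a = b`: `≥ 0`), so `g^{Δ₁₂,Δ₃₄}(x,x) = λ_ℓ⁻¹ Σ_n a_n(a,b) x^{Δ+n}`
coefficientwise. [cite: DolanOsborn2004, §3 eq. (3.10)] -/
theorem SatisfiesCoeffCasimir.diagCoeff_eq_ab {a b Δ : ℝ} {ℓ : ℕ} {k : ℕ × ℕ → ℝ}
    (hΔ : unitarityBound3D ℓ < Δ) (hreg : ¬ accidentalDegeneracy3D Δ ℓ)
    (hk : SatisfiesCoeffCasimir a b Δ ℓ k) (hks : ∀ p : ℕ × ℕ, k (p.2, p.1) = k p)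
    (hkl : HasLeadingPart ℓ k) (n : ℕ) :
    diagCoeff k (ℓ + n) = hrLevelSumAB a b Δ ℓ n / legendreLam ℓ := by
  rw [hk.eq_hrMonomialCoeffAB hΔ hreg hks hkl]
  exact diagCoeff_hrMonomialCoeffAB a b Δ ℓ n

/-- For `a = b` the diagonal coefficients of a solution are non-negative. [cite: DolanOsborn2004, §3 eq. (3.11)] -/
theorem SatisfiesCoeffCasimir.diagCoeff_nonneg_of_self {a Δ : ℝ} {ℓ : ℕ} {k : ℕ × ℕ → ℝ}
    (hΔ : unitarityBound3D ℓ < Δ) (hreg : ¬ accidentalDegeneracy3D Δ ℓ)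
    (hk : SatisfiesCoeffCasimir a a Δ ℓ k) (hks : ∀ p : ℕ × ℕ, k (p.2, p.1) = k p)
    (hkl : HasLeadingPart ℓ k) (N : ℕ) : 0 ≤ diagCoeff k N := by
  rw [hk.eq_hrMonomialCoeffAB hΔ hreg hks hkl]
  exact Finset.sum_nonneg fun p _ => hrMonomialCoeffAB_self_nonneg a hΔ p

end Literature.MathematicalPhysics.QuantumFieldTheory.ConformalBootstrap3D
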